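import Summits.QuantumFields.YangMills.Theorems.VirialFluxGapCommutatorInsertion
import Summits.QuantumFields.YangMills.Theorems.VirialFluxGapAnchorChartSmooth
import Literature.MathematicalPhysics.QuantumFieldTheory.Balaban1983to89.T4WilsonDatumBounds
import Literature.MathematicalPhysics.QuantumFieldTheory.Balaban1983to89.T4ExpWindowSmallField
import Literature.MathematicalPhysics.QuantumFieldTheory.Federbush1986.PureAveragesSU2Lemma12
import HarnessLib

/-!
# Route `VirialFluxGap` (YangMills): THE EULER-DEFECT ALGEBRA OF THE EXPLICIT CENTRAL FIELD, TERM BY TERM — part 1: quaternion lemmas, the temporal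
# identity, the slot cores and `D − 2T = −2Re(E·(1 − h̄))` (free-hands helper for ⟨stmt-QuantumFields-24141⟩ `PeriodicSoftness`, clause (P2) "drive ≥ 2(1−ε)F₀")

Width seat `ym-line-sfw-p2-w3` g59 (cell ym-idea-1, free hands), `--supports stmt-QuantumFields-24141`.

The zero-flux deficit is a sum of terms `T = 2 − Re tr(hol)` (✓`ringPoly_eq_sum_terms`: temporal bonds `q q̄′`, seam bonds and plaquettes
`q₁q₂q̄₃q̄₄`), and the drive of a right-multiplication field `Y` is the matching sum of MINUS THE INSERTIONS (✓`fderiv_ringPoly_apply`).  For the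
explicit central field (✓`CentralFieldDefs`) the direction at a variable with link quaternion `q` and ANCHOR `c` (the central projection's value
there: `c_k = lift(σ_k, z_k)` on wrap block `k`, `1` on plain ∕ tree links, `c₄` on seam sites) is the pure quaternion
`A = Im(c̄·q) + (σ∕2)·Im c`, and in every term the two PARALLEL slots share their anchor: `hol = q₁q₂q̄₃q̄₄` with anchors `(c, c′, c, c′)`.
The companion file `VirialFluxGapEulerDefectInequality` proves the EULER-DEFECT INEQUALITY `D ≥ 2T − (4r + 3ρ)·(3T + 4·Σ_j ‖q_j − c_j‖²)`
(`r ≥ max_j ‖q_j − c_j‖`, `ρ ≥ ‖σc − 1‖, ‖σ′c′ − 1‖`, `D = −2Re(q₁A₁q₂q̄₃q̄₄ + q₁q₂A₂q̄₃q̄₄ − q₁q₂A₃q̄₃q̄₄ − q₁q₂q̄₃A₄q̄₄)` the term's drive)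
with NO coercivity input; this file carries the algebra it rests on:

* §1 small quaternion lemmas (`Im x = x − Re x`, `‖Im x‖ ≤ ‖x‖`, `‖w − 1‖² = 2 − 2Re w` and `w² = 2(Re w)w − 1` for unit `w`, cancellation of units,
  ★ `c·[c,x] = [c,x]·c̄`, `1 − Re(c̄q) = ‖q − c‖²∕2`);
* §2 ★★ `temporal_euler_identity` — the temporal word is EXACT: `D = (Re(c̄q) + Re(c̄q′))·T` (the `½σz` parts cancel identically), and
  `temporal_euler_le` — `D ≥ 2T − r²T`;
* §3.1 the SLOT CORES `κ = q·Im(c̄q) − q + c = c(c̄q − 1)² + (1 − Re(c̄q))q` (★ `kappa_eq`, `‖κ‖ ≤ (3∕2)‖q − c‖²`) and `Im(c̄q)·q̄ + q̄ − c̄ = (1 − Re(c̄q))q̄`,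
  telescoping norm bounds for 2, 3, 4 unit factors;
* §3.2 ★ `re_hdot_mul_star_eq_zero` (`Re(ḣ·h̄) = 0` for pure directions) and ★★ `drive_sub_two_eq`: `D − 2T = −2Re(E·(1 − h̄))`, `E := ḣ − (h − 1)`.

HONEST LABEL: finite-dimensional algebra; the per-term instantiation (reading the anchors off ✓`centralDir`) and the summation into (P2) are NOT here;
⟨24141⟩ and ⟨22884⟩ stay OPEN; the Yang–Mills mass gap is NOT proved by this; no summit is proved by a line.  THEOREMS ONLY (no `def`, no `sorry`).

References: [cite: CosteEtAl1985]; [cite: Luscher1983, §2].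
-/

set_option autoImplicit false

noncomputable section

open scoped Quaternion

namespace Summit.QuantumFields.YangMills.Theorems.VirialFluxGap.EulerDefect

open Summit.QuantumFields.YangMills.Theorems.VirialFluxGap.CommutatorInsertion
open Summit.QuantumFields.YangMills.Theorems.VirialFluxGap.AnchorSlice (re_conj_unit)
open Literature.MathematicalPhysics.QuantumLattice (sq_norm_eq_sum_sq)
open Literature.MathematicalPhysics.QuantumFieldTheory.Federbush1986.SU2 (norm_im_le)
open Literature.MathematicalPhysics.QuantumFieldTheory.Balaban1983to89.T4ExpWindowSmallField (norm_sub_one_sq)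
open Literature.MathematicalPhysics.QuantumFieldTheory.Balaban1983to89.T4WilsonDatumBounds (norm_mul_sub_mul_le_of_norm_eq_one
  norm_mul₃_sub_le_of_norm_eq_one)

/-! ## §1 Small quaternion lemmas (the generic ones — `‖Im x‖ ≤ ‖x‖`, `‖w − 1‖² = 2 − 2Re w`, `Re(c x c̄) = Re x`, telescoping of unit
products — are imported: ✓`Federbush1986.SU2.norm_im_le`, ✓`T4ExpWindowSmallField.norm_sub_one_sq`, ✓`AnchorSlice.re_conj_unit`,
✓`T4WilsonDatumBounds.norm_mul_sub_mul_le_of_norm_eq_one` ∕ `norm_mul₃_sub_le_of_norm_eq_one`) -/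

/-- `Im x = x − Re x`. [folklore] -/
theorem im_eq_sub_re (x : ℍ) : x.im = x - (x.re : ℍ) := by
  ext <;> simp

/-- `Im(σc − 1) = σ·Im c`, hence `‖Im c‖ ≤ ‖σ c − 1‖` for `σ = ±1`. [folklore] -/
theorem norm_im_le_norm_sign_sub_one {σ : ℝ} (hσ : σ = 1 ∨ σ = -1) (c : ℍ) : ‖c.im‖ ≤ ‖σ • c - 1‖ := by
  have e : (σ • c - 1).im = σ • c.im := by ext <;> simp
  have hs : |σ| = 1 := by rcases hσ with h1 | h1 <;> simp [h1]
  have h := norm_im_le (σ • c - 1)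
  rw [e, norm_smul, Real.norm_eq_abs, hs, one_mul] at h
  exact h

/-- Cancellation `ū·(u·x) = x` for a unit `u`. [folklore] -/
theorem star_mul_cancel_left {u : ℍ} (hu : ‖u‖ = 1) (x : ℍ) : star u * (u * x) = x := by
  rw [← mul_assoc, (mul_star_self_of_norm hu).2, one_mul]

/-- Cancellation `u·(ū·x) = x` for a unit `u`. [folklore] -/
theorem mul_star_cancel_left {u : ℍ} (hu : ‖u‖ = 1) (x : ℍ) : u * (star u * x) = x := by
  rw [← mul_assoc, (mul_star_self_of_norm hu).1, one_mul]

/-- Cancellation `(x·u)·ū = x` for a unit `u`. [folklore] -/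
theorem mul_mul_star_cancel {u : ℍ} (hu : ‖u‖ = 1) (x : ℍ) : x * u * star u = x := by
  rw [mul_assoc, (mul_star_self_of_norm hu).1, mul_one]

/-- Cancellation `(x·ū)·u = x` for a unit `u`. [folklore] -/
theorem mul_star_mul_cancel {u : ℍ} (hu : ‖u‖ = 1) (x : ℍ) : x * star u * u = x := by
  rw [mul_assoc, (mul_star_self_of_norm hu).2, mul_one]

/-- For a unit `w`: `‖1 − w‖² = 2 − 2·Re w`. [folklore] -/
theorem norm_one_sub_sq {w : ℍ} (hw : ‖w‖ = 1) : ‖1 - w‖ ^ 2 = 2 - 2 * w.re := by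
  rw [← norm_neg, neg_sub, norm_sub_one_sq hw]

/-- For a unit `w`: `w² = 2(Re w)·w − 1`. [folklore] -/
theorem mul_self_eq_of_unit {w : ℍ} (hw : ‖w‖ = 1) : w * w = (2 * w.re) • w - 1 := by
  have h1 := (mul_star_self_of_norm hw).1
  rw [star_eq_two_re_sub', mul_sub, Quaternion.mul_coe_eq_smul] at h1
  rw [← h1]; abel

/-- `[Im c, x] = [c, x]`. [folklore] -/
theorem im_comm_eq (c x : ℍ) : c.im * x - x * c.im = c * x - x * c := by
  rw [im_eq_sub_re, sub_mul, mul_sub, Quaternion.coe_mul_eq_smul, Quaternion.mul_coe_eq_smul]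
  abel

/-- ★ For a unit `c`: `c·[c,x] = [c,x]·c̄` (from `c² = 2(Re c)c − 1`; in block letters: `[c,c′] = 2·Im c × Im c′ ⊥ Im c`). [folklore] -/
theorem mul_comm_eq_comm_mul_star {c : ℍ} (hc : ‖c‖ = 1) (x : ℍ) : c * (c * x - x * c) = (c * x - x * c) * star c := by
  have hsq := mul_self_eq_of_unit hc
  have h2 : (c * x - x * c) * star c = (2 * c.re) • (c * x - x * c) - (c * x - x * c) * c := by
    rw [star_eq_two_re_sub', mul_sub, Quaternion.mul_coe_eq_smul]
  have l : c * (c * x) = (2 * c.re) • (c * x) - x := by rw [← mul_assoc, hsq, sub_mul, smul_mul_assoc, one_mul]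
  have r : (c * x - x * c) * c = c * (x * c) - ((2 * c.re) • (x * c) - x) := by
    rw [sub_mul, mul_assoc x c c, hsq, mul_sub, mul_smul_comm, mul_one, mul_assoc]
  rw [h2, mul_sub, l, r, smul_sub]
  abel

/-- `‖x·u‖ = ‖x‖` and `‖u·x‖ = ‖x‖` for a unit `u`. [folklore] -/
theorem norm_mul_unit {u : ℍ} (hu : ‖u‖ = 1) (x : ℍ) : ‖x * u‖ = ‖x‖ ∧ ‖u * x‖ = ‖x‖ := by
  rw [norm_mul, norm_mul, hu, mul_one, one_mul]; exact ⟨rfl, rfl⟩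

/-- The proximity of a link to its anchor in anchor letters: `‖c̄q − 1‖ = ‖q − c‖` for a unit `c`. [folklore] -/
theorem norm_star_mul_sub_one {c : ℍ} (hc : ‖c‖ = 1) (q : ℍ) : ‖star c * q - 1‖ = ‖q - c‖ := by
  have e : star c * q - 1 = star c * (q - c) := by rw [mul_sub, (mul_star_self_of_norm hc).2]
  rw [e, norm_mul, norm_star, hc, one_mul]

/-- For units `c, q`: `1 − Re(c̄q) = ‖q − c‖²∕2`. [folklore] -/
theorem one_sub_re_eq {c q : ℍ} (hc : ‖c‖ = 1) (hq : ‖q‖ = 1) : 1 - (star c * q).re = ‖q - c‖ ^ 2 / 2 := by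
  have hw : ‖star c * q‖ = 1 := by rw [norm_mul, norm_star, hc, hq, mul_one]
  have h := norm_sub_one_sq hw
  rw [norm_star_mul_sub_one hc] at h
  linarith

/-- `‖Im(c̄q)‖ ≤ ‖q − c‖` for a unit `c`. [folklore] -/
theorem norm_im_star_mul_le {c : ℍ} (hc : ‖c‖ = 1) (q : ℍ) : ‖(star c * q).im‖ ≤ ‖q - c‖ := by
  have e : (star c * q).im = (star c * q - 1).im := by ext <;> simp
  rw [e, ← norm_star_mul_sub_one hc]
  exact norm_im_le _

/-! ## §2 The temporal word: an exact identity -/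

/-- ★★ **Temporal Euler identity.** For unit `q, q′` with a common unit anchor `c` and directions `A = Im(c̄q) + b`, `A′ = Im(c̄q′) + b` (the same
`b` — the `½σz` parts of the central field agree on the two slots of a temporal bond and CANCEL), the drive of the temporal word `T = 2 − 2Re(q q̄′)`
is EXACTLY `D := −2Re(q(A − A′)q̄′) = (Re(c̄q) + Re(c̄q′))·T`. [cite: CosteEtAl1985] -/
theorem temporal_euler_identity {q q' c : ℍ} (hq : ‖q‖ = 1) (hq' : ‖q'‖ = 1) (hc : ‖c‖ = 1) (b : ℍ) {A A' : ℍ}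
    (hA : A = (star c * q).im + b) (hA' : A' = (star c * q').im + b) :
    -2 * (q * (A - A') * star q').re = ((star c * q).re + (star c * q').re) * (2 - 2 * (q * star q').re) := by
  -- anchor letters `w = c̄q`, `w' = c̄q'`
  set w := star c * q with hw_def
  set w' := star c * q' with hw'_def
  have hw : ‖w‖ = 1 := by rw [hw_def, norm_mul, norm_star, hc, hq, one_mul]
  have hw' : ‖w'‖ = 1 := by rw [hw'_def, norm_mul, norm_star, hc, hq', one_mul]
  have hqw : q = c * w := by rw [hw_def, mul_star_cancel_left hc]
  have hqw' : q' = c * w' := by rw [hw'_def, mul_star_cancel_left hc]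
  have hAA : A - A' = (w - w') - ((w.re - w'.re : ℝ) : ℍ) := by
    rw [hA, hA', im_eq_sub_re, im_eq_sub_re]; push_cast; abel
  -- conjugation by `c` drops out of real parts
  have e1 : (q * (A - A') * star q').re = (w * (A - A') * star w').re := by
    rw [hqw, hqw', star_mul, show c * w * (A - A') * (star w' * star c) = c * (w * (A - A') * star w') * star c by noncomm_ring,
      re_conj_unit hc]
  have e2 : (q * star q').re = (w * star w').re := by
    rw [hqw, hqw', star_mul, show c * w * (star w' * star c) = c * (w * star w') * star c by noncomm_ring, re_conj_unit hc]
  -- the word in anchor letters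
  have e3 : w * (A - A') * star w' = w * w * star w' - w - (w.re - w'.re) • (w * star w') := by
    rw [hAA, mul_sub, Quaternion.mul_coe_eq_smul, sub_mul, smul_mul_assoc, mul_sub, sub_mul, mul_mul_star_cancel hw']
  have e4 : (w * w * star w').re = 2 * w.re * (w * star w').re - w'.re := by
    rw [mul_self_eq_of_unit hw, sub_mul, smul_mul_assoc, one_mul, Quaternion.re_sub, Quaternion.re_smul, Quaternion.re_star, smul_eq_mul]
  rw [e1, e2, e3, Quaternion.re_sub, Quaternion.re_sub, Quaternion.re_smul, e4, smul_eq_mul]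
  ring

/-- ★★ **Temporal Euler inequality**: with `1 − Re(c̄q) = ‖q − c‖²∕2`, the identity reads `D = 2T − ½(‖q − c‖² + ‖q′ − c‖²)·T`; in particular
`D ≥ 2T − r²·T` whenever `‖q − c‖, ‖q′ − c‖ ≤ r`. [cite: CosteEtAl1985] -/
theorem temporal_euler_le {q q' c : ℍ} (hq : ‖q‖ = 1) (hq' : ‖q'‖ = 1) (hc : ‖c‖ = 1) (b : ℍ) {A A' : ℍ}
    (hA : A = (star c * q).im + b) (hA' : A' = (star c * q').im + b) {r : ℝ} (hr : ‖q - c‖ ≤ r) (hr' : ‖q' - c‖ ≤ r) :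
    -2 * (q * (A - A') * star q').re =
        2 * (2 - 2 * (q * star q').re) - (‖q - c‖ ^ 2 + ‖q' - c‖ ^ 2) / 2 * (2 - 2 * (q * star q').re) ∧
      2 * (2 - 2 * (q * star q').re) - r ^ 2 * (2 - 2 * (q * star q').re) ≤ -2 * (q * (A - A') * star q').re := by
  have h := temporal_euler_identity hq hq' hc b hA hA'
  have h1 := one_sub_re_eq hc hq
  have h2 := one_sub_re_eq hc hq'
  have hT : 0 ≤ 2 - 2 * (q * star q').re := by
    have hu : ‖q * star q'‖ = 1 := by rw [norm_mul, norm_star, hq, hq', mul_one]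
    have := norm_one_sub_sq hu
    nlinarith [sq_nonneg ‖1 - q * star q'‖]
  have hω : (star c * q).re + (star c * q').re = 2 - (‖q - c‖ ^ 2 + ‖q' - c‖ ^ 2) / 2 := by linarith
  refine ⟨by rw [h, hω]; ring, ?_⟩
  rw [h, hω]
  have hd : ‖q - c‖ ^ 2 ≤ r ^ 2 := pow_le_pow_left₀ (norm_nonneg _) hr 2
  have hd' : ‖q' - c‖ ^ 2 ≤ r ^ 2 := pow_le_pow_left₀ (norm_nonneg _) hr' 2
  nlinarith [h1, h2, hd, hd', hT]

/-! ## §3 The four-slot word `q₁q₂q̄₃q̄₄` with anchors `(c, c′, c, c′)` -/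

/-! ### §3.1 The small cores of the telescoping -/

/-- ★ The SLOT CORE `κ = q·Im(c̄q) − q + c` is second order: `κ = c(c̄q − 1)² + (1 − Re(c̄q))·q`. [cite: CosteEtAl1985] -/
theorem kappa_eq {c : ℍ} (hc : ‖c‖ = 1) (q : ℍ) :
    q * (star c * q).im - q + c = c * (star c * q - 1) * (star c * q - 1) + (1 - (star c * q).re) • q := by
  have hcw : c * (star c * q) = q := mul_star_cancel_left hc q
  rw [im_eq_sub_re, mul_sub, Quaternion.mul_coe_eq_smul, sub_smul, one_smul,
    show c * (star c * q - 1) * (star c * q - 1) = c * (star c * q) * (star c * q) - c * (star c * q) - c * (star c * q) + c by noncomm_ring, hcw]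
  abel

/-- ★ `‖q·Im(c̄q) − q + c‖ ≤ (3∕2)·‖q − c‖²` for units `c, q`. [cite: CosteEtAl1985] -/
theorem norm_kappa_le {c q : ℍ} (hc : ‖c‖ = 1) (hq : ‖q‖ = 1) : ‖q * (star c * q).im - q + c‖ ≤ 3 / 2 * ‖q - c‖ ^ 2 := by
  rw [kappa_eq hc]
  have h1 : ‖c * (star c * q - 1) * (star c * q - 1)‖ ≤ ‖q - c‖ ^ 2 := by
    rw [norm_mul, norm_mul, hc, one_mul, norm_star_mul_sub_one hc, sq]
  have hω := one_sub_re_eq hc hq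
  have h2 : ‖(1 - (star c * q).re) • q‖ = ‖q - c‖ ^ 2 / 2 := by
    rw [norm_smul, hq, mul_one, hω, Real.norm_eq_abs, abs_of_nonneg (by positivity)]
  calc ‖c * (star c * q - 1) * (star c * q - 1) + (1 - (star c * q).re) • q‖
      ≤ ‖c * (star c * q - 1) * (star c * q - 1)‖ + ‖(1 - (star c * q).re) • q‖ := norm_add_le _ _
    _ ≤ 3 / 2 * ‖q - c‖ ^ 2 := by rw [h2]; linarith

/-- ★ The CONJUGATE SLOT CORE: `Im(c̄q)·q̄ + q̄ − c̄ = (1 − Re(c̄q))·q̄` for a unit `q`. [cite: CosteEtAl1985] -/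
theorem im_mul_star_add_eq {q : ℍ} (hq : ‖q‖ = 1) (c : ℍ) :
    (star c * q).im * star q + star q - star c = (1 - (star c * q).re) • star q := by
  rw [im_eq_sub_re, sub_mul, mul_mul_star_cancel hq, Quaternion.coe_mul_eq_smul, sub_smul, one_smul]
  abel

/-- `‖Im(c̄q)·q̄ + q̄ − c̄‖ = ‖q − c‖²∕2` for units. [cite: CosteEtAl1985] -/
theorem norm_im_mul_star_add_eq {c q : ℍ} (hc : ‖c‖ = 1) (hq : ‖q‖ = 1) :
    ‖(star c * q).im * star q + star q - star c‖ = ‖q - c‖ ^ 2 / 2 := by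
  rw [im_mul_star_add_eq hq, norm_smul, norm_star, hq, mul_one, one_sub_re_eq hc hq, Real.norm_eq_abs, abs_of_nonneg (by positivity)]

/-- Telescoping of four unit factors (`‖h − h_tor‖ ≤ Σ_j ‖q_j − c_j‖`; two and three factors are ✓`norm_mul_sub_mul_le_of_norm_eq_one`,
✓`norm_mul₃_sub_le_of_norm_eq_one`). [folklore] -/
theorem norm_tel4 {x₁ x₂ x₃ x₄ y₁ y₂ y₃ y₄ : ℍ} (hx₂ : ‖x₂‖ = 1) (hx₃ : ‖x₃‖ = 1) (hx₄ : ‖x₄‖ = 1) (hy₁ : ‖y₁‖ = 1) (hy₂ : ‖y₂‖ = 1)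
    (hy₃ : ‖y₃‖ = 1) : ‖x₁ * x₂ * x₃ * x₄ - y₁ * y₂ * y₃ * y₄‖ ≤ ‖x₁ - y₁‖ + ‖x₂ - y₂‖ + ‖x₃ - y₃‖ + ‖x₄ - y₄‖ := by
  have h := norm_mul_sub_mul_le_of_norm_eq_one (x := x₁ * x₂ * x₃) (y := x₄) (x' := y₁ * y₂ * y₃) (y' := y₄) hx₄
    (by rw [norm_mul, norm_mul, hy₁, hy₂, hy₃, mul_one, mul_one])
  have h' := norm_mul₃_sub_le_of_norm_eq_one (x := x₁) hx₂ hx₃ hy₁ hy₂ (z := x₃) (z' := y₃)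
  linarith

/-! ### §3.2 `Re(ḣ·h̄) = 0` and `D − 2T = −2Re(E·(1 − h̄))` -/

/-- ★ `Re(ḣ·h̄) = 0`: each insertion term times `h̄` is a conjugate of the PURE direction `A_j`. [cite: CosteEtAl1985] -/
theorem re_hdot_mul_star_eq_zero {q₁ q₂ q₃ q₄ : ℍ} (hq₁ : ‖q₁‖ = 1) (hq₂ : ‖q₂‖ = 1) (hq₃ : ‖q₃‖ = 1) (hq₄ : ‖q₄‖ = 1)
    {A₁ A₂ A₃ A₄ : ℍ} (hA₁ : A₁.re = 0) (hA₂ : A₂.re = 0) (hA₃ : A₃.re = 0) (hA₄ : A₄.re = 0) :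
    ((q₁ * A₁ * q₂ * star q₃ * star q₄ + q₁ * q₂ * A₂ * star q₃ * star q₄ - q₁ * q₂ * A₃ * star q₃ * star q₄
        - q₁ * q₂ * star q₃ * A₄ * star q₄) * star (q₁ * q₂ * star q₃ * star q₄)).re = 0 := by
  have hq₃' : ‖star q₃‖ = 1 := by rw [norm_star, hq₃]
  have hs : star (q₁ * q₂ * star q₃ * star q₄) = q₄ * (q₃ * (star q₂ * star q₁)) := by
    rw [star_mul, star_mul, star_mul, star_star, star_star]
  rw [hs]
  have t1 : (q₁ * A₁ * q₂ * star q₃ * star q₄ * (q₄ * (q₃ * (star q₂ * star q₁)))).re = 0 := by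
    rw [show q₁ * A₁ * q₂ * star q₃ * star q₄ * (q₄ * (q₃ * (star q₂ * star q₁)))
        = q₁ * (A₁ * (q₂ * (star q₃ * (star q₄ * (q₄ * (q₃ * (star q₂ * star q₁))))))) by noncomm_ring,
      star_mul_cancel_left hq₄, star_mul_cancel_left hq₃, mul_star_cancel_left hq₂, ← mul_assoc, re_conj_unit hq₁, hA₁]
  have t2 : (q₁ * q₂ * A₂ * star q₃ * star q₄ * (q₄ * (q₃ * (star q₂ * star q₁)))).re = 0 := by
    rw [show q₁ * q₂ * A₂ * star q₃ * star q₄ * (q₄ * (q₃ * (star q₂ * star q₁)))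
        = q₁ * (q₂ * (A₂ * (star q₃ * (star q₄ * (q₄ * (q₃ * (star q₂ * star q₁))))))) by noncomm_ring,
      star_mul_cancel_left hq₄, star_mul_cancel_left hq₃,
      show q₁ * (q₂ * (A₂ * (star q₂ * star q₁))) = q₁ * (q₂ * A₂ * star q₂) * star q₁ by noncomm_ring,
      re_conj_unit hq₁, re_conj_unit hq₂, hA₂]
  have t3 : (q₁ * q₂ * A₃ * star q₃ * star q₄ * (q₄ * (q₃ * (star q₂ * star q₁)))).re = 0 := by
    rw [show q₁ * q₂ * A₃ * star q₃ * star q₄ * (q₄ * (q₃ * (star q₂ * star q₁)))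
        = q₁ * (q₂ * (A₃ * (star q₃ * (star q₄ * (q₄ * (q₃ * (star q₂ * star q₁))))))) by noncomm_ring,
      star_mul_cancel_left hq₄, star_mul_cancel_left hq₃,
      show q₁ * (q₂ * (A₃ * (star q₂ * star q₁))) = q₁ * (q₂ * A₃ * star q₂) * star q₁ by noncomm_ring,
      re_conj_unit hq₁, re_conj_unit hq₂, hA₃]
  have t4 : (q₁ * q₂ * star q₃ * A₄ * star q₄ * (q₄ * (q₃ * (star q₂ * star q₁)))).re = 0 := by
    rw [show q₁ * q₂ * star q₃ * A₄ * star q₄ * (q₄ * (q₃ * (star q₂ * star q₁)))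
        = q₁ * (q₂ * (star q₃ * (A₄ * (star q₄ * (q₄ * (q₃ * (star q₂ * star q₁))))))) by noncomm_ring,
      star_mul_cancel_left hq₄,
      show q₁ * (q₂ * (star q₃ * (A₄ * (q₃ * (star q₂ * star q₁))))) = q₁ * (q₂ * (star q₃ * A₄ * star (star q₃)) * star q₂) * star q₁ by
        rw [star_star]; noncomm_ring,
      re_conj_unit hq₁, re_conj_unit hq₂, re_conj_unit hq₃', hA₄]
  rw [sub_mul, sub_mul, add_mul, Quaternion.re_sub, Quaternion.re_sub, Quaternion.re_add, t1, t2, t3, t4]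
  norm_num

/-- ★★ **`D − 2T = −2Re(E·(1 − h̄))`** with the Euler defect `E = ḣ − (h − 1)`, for pure directions. [cite: CosteEtAl1985] -/
theorem drive_sub_two_eq {q₁ q₂ q₃ q₄ : ℍ} (hq₁ : ‖q₁‖ = 1) (hq₂ : ‖q₂‖ = 1) (hq₃ : ‖q₃‖ = 1) (hq₄ : ‖q₄‖ = 1)
    {A₁ A₂ A₃ A₄ : ℍ} (hA₁ : A₁.re = 0) (hA₂ : A₂.re = 0) (hA₃ : A₃.re = 0) (hA₄ : A₄.re = 0) :
    -2 * (q₁ * A₁ * q₂ * star q₃ * star q₄ + q₁ * q₂ * A₂ * star q₃ * star q₄ - q₁ * q₂ * A₃ * star q₃ * star q₄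
          - q₁ * q₂ * star q₃ * A₄ * star q₄).re - 2 * (2 - 2 * (q₁ * q₂ * star q₃ * star q₄).re) =
      -2 * (((q₁ * A₁ * q₂ * star q₃ * star q₄ + q₁ * q₂ * A₂ * star q₃ * star q₄ - q₁ * q₂ * A₃ * star q₃ * star q₄
          - q₁ * q₂ * star q₃ * A₄ * star q₄) - (q₁ * q₂ * star q₃ * star q₄ - 1)) * (1 - star (q₁ * q₂ * star q₃ * star q₄))).re := by
  have hz := re_hdot_mul_star_eq_zero hq₁ hq₂ hq₃ hq₄ hA₁ hA₂ hA₃ hA₄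
  set h := q₁ * q₂ * star q₃ * star q₄ with hh
  set hd := q₁ * A₁ * q₂ * star q₃ * star q₄ + q₁ * q₂ * A₂ * star q₃ * star q₄ - q₁ * q₂ * A₃ * star q₃ * star q₄
          - q₁ * q₂ * star q₃ * A₄ * star q₄ with hhd
  have hu : ‖h‖ = 1 := by rw [hh, norm_mul, norm_mul, norm_mul, norm_star, norm_star, hq₁, hq₂, hq₃, hq₄]; norm_num
  have hhs : h * star h = 1 := (mul_star_self_of_norm hu).1
  rw [show (hd - (h - 1)) * (1 - star h) = hd - hd * star h - h + 1 + h * star h - star h by noncomm_ring, hhs]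
  simp only [Quaternion.re_sub, Quaternion.re_add, Quaternion.re_one, Quaternion.re_star, hz]
  ring

end Summit.QuantumFields.YangMills.Theorems.VirialFluxGap.EulerDefect

end
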